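import Literature.NumberTheory.EllipticCurves.SerreOpenImageReductionInertiaProofs
import HarnessLib

/-!
# Route `GenusKolyvaginAtTwo`, crux 23491 `GenusDeepSupplyAtTwoNegDiscNarrow` (and 25504), registered stub C‴:
# DEPTH ZERO IS DECIDED AT A RAMIFIED PRIME — the kernel of the reduction criterion (LEAD gk2-p1 g21)

`--supports stmt-BirchSwinnertonDyer-23491 --as helper`.  THEOREMS ONLY (no definition, no named fact, no `sorry`).  **BSD is NOT proved by this
file and no item is closed by it.**

WHY.  Depth zero (`M₀ = 0`: `y_K ∉ 2E(K[1])`) closes the supply cruxes' deep clause with `n = 1` (p760906 `GenusSupplyNarrow.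
exists_deepWitness_of_depth_zero`); on the `#Sel₂(E) = 1` cell of 23491 the registered stub C‴ is EXACTLY «`M₀ = 0`» (memo
`DEPTH-ZERO-REDUCTION-CRITERION-g21.md`, evidence on 23491).  This file proves the GROUP-THEORETIC KERNEL of the criterion «`M₀ = 0` as soon as the
Heegner point does not reduce into the reduction of the torsion at a prime `𝔓` over a RAMIFIED prime `ℓ₀ ∣ d_K`»:

Let `red = geomReduction : E(ℚ̄) → Ẽ(𝔽̄_{ℓ₀})` (tree, `ℓ₀ ∤ Δ_min`), `γ ∈ I_𝔓 ≤ Γ_ℚ` an inertia element (so `red ∘ γ = red`, tree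
`geomReduction_smul_of_mem_inertia`), `A ≤ E(ℚ̄)` a `γ`-stable subgroup WITHOUT `2`-torsion (instantiation: the image of `E(K[1]) = E(H)`, no
`2`-torsion by (H2) + `ρ̄_{E,2}` onto, tree `GenusExact.torsionBy_two_ringClassField_eq_bot`; `γ`-stable since `H/ℚ` is normal), `Y ∈ A` with
`γ • Y = −Y + t`, `t ∈ A` of ODD order and `γ • t = t` (instantiation: `Y = y_K`, `γ|_K = τ`, `t = y_K + τ y_K ∈ E(K)_tors`, Gross Prop. 5.3 with
`w(E) = +1`, tree `X11b.KolyvaginBottom.isOfFinAddOrder_map_sub_neg_rootNumber_smul`; odd order because `E(K)[2] = 0`).  THEN: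
* §1 `red Y ∈ Ẽ[2] + red(torsion)`: precisely `2 • red (Y − s) = 0` for the half `s = ((m+1)/2) • t` of `t` (`m = addOrderOf t`);
* §2 **`(∃ Q ∈ A, 2 • Q = Y) → red Y = red s`** (`geomReduction_eq_of_two_smul_of_inertia_anti`): `Q′ = Q − (half of s)` has
  `γQ′ + Q′ ∈ A[2] = 0`, so `red Q′ = red (γQ′) = − red Q′`, `red Y′ = 2 red Q′ = 0`;
* §3 contrapositive, the CRITERION: **`red Y ∉ red '' {torsion of A}` ⟹ `Y ∉ 2A`** — for the Heegner point: if `y_K` does not reduce, at a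
  prime over a ramified `ℓ₀ ∣ d_K`, to the reduction of a torsion point of `E(H)` (for `E(ℚ)_tors = 0` typically: `y_K ≢ Õ`), then `M₀ = 0`.
The existence of such `γ` (an element of `I(𝔓 ∣ ℓ₀) ≤ Γ_ℚ` restricting to `τ` on `K` when `ℓ₀ ∣ d_K`; `#I = e`, Hilbert theory) and the
instantiation plumbing (`RatClosure.pointsEquiv`, `KolyvaginHeegnerData.toGeomPoints`) are NOT done here.

References: [GrossLMS1991] §5 Prop. 5.3, §4 (4.1); [Serre1972] §1.11 Prop. 11 (inertia acts trivially on `Ẽ`); [SilvermanAEC2009] VII.2.1, VIII.§1.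
-/

set_option autoImplicit false
set_option linter.dupNamespace false -- `Summit.<P>.<Sub>` repeats `BirchSwinnertonDyer` (D-0017)

noncomputable section

open scoped Classical NumberField Pointwise

namespace Summit.BirchSwinnertonDyer.BirchSwinnertonDyer.Theorems.GenusSupplyNarrow

open IsDedekindDomain Field WeierstrassCurve Literature.NumberTheory.EllipticCurves Literature.NumberTheory.GaloisRepresentations
  Rat.HeightOneSpectrum

variable {p : ℕ} [Fact p.Prime] {W : WeierstrassCurve ℚ} [W.IsGloballyMinimal] [W.IsElliptic]
  (hΔ : ¬ (p : ℤ) ∣ minimalDiscriminantInt W)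
  {𝔓 : Ideal (absIntegers (𝓞 ℚ) ℚ)}
  (hmem : ∀ x : absIntegers (𝓞 ℚ) ℚ, x ∈ 𝔓 ↔ (x : AlgebraicClosure ℚ) ∈ (placeOver p).nonunits)
  {γ : absoluteGaloisGroup ℚ} (hγ : γ ∈ 𝔓.inertia (absoluteGaloisGroup ℚ))

/-! ## §1 Anti-invariant points under an inertia element reduce into the `2`-torsion -/

include hmem hγ in
/-- **An inertia-anti-invariant point reduces to a `2`-torsion point**: `γ ∈ I_𝔓`, `γ • Z = −Z` ⟹ `2 • red Z = 0` (inertia acts trivially on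
`Ẽ`, so `red Z = red (γ • Z) = − red Z`). [cite: Serre1972, §1.11, Prop. 11 (proof)] -/
theorem two_smul_geomReduction_eq_zero_of_inertia_anti {Z : W.geomPoints} (hZ : γ • Z = -Z) :
    (2 : ℤ) • geomReduction hΔ Z = 0 := by
  have h := geomReduction_smul_of_mem_inertia (p := p) hΔ hmem hγ Z
  rw [hZ, map_neg, neg_eq_iff_add_eq_zero] at h
  -- `red Z + red Z = 0`
  rw [two_smul]
  exact h

omit [W.IsGloballyMinimal] [W.IsElliptic] in
/-- `γ • (n • P) = n • (γ • P)` on `E(ℚ̄)` (the Galois action is by group automorphisms). [folklore] -/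
theorem smul_zsmul_geomPoints' (g : absoluteGaloisGroup ℚ) (n : ℤ) (P : W.geomPoints) : g • (n • P) = n • (g • P) :=
  map_zsmul (DistribSMul.toAddMonoidHom W.geomPoints g) n P

/-- **Halving an odd-order point**: for `t` of odd additive order `m`, `s := ((m + 1) / 2) • t` satisfies `2 • s = t`. [folklore] -/
theorem two_smul_half_of_odd_addOrderOf {A : Type*} [AddCommGroup A] {t : A} (hodd : Odd (addOrderOf t)) :
    (2 : ℤ) • ((((addOrderOf t + 1) / 2 : ℕ) : ℤ) • t) = t := by
  obtain ⟨k, hk⟩ := hodd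
  have hdiv : (addOrderOf t + 1) / 2 = k + 1 := by omega
  rw [hdiv, smul_smul]
  have : (2 : ℤ) * ((k + 1 : ℕ) : ℤ) = ((addOrderOf t : ℕ) : ℤ) + 1 := by push_cast; omega
  rw [this, add_smul, one_smul, natCast_zsmul, addOrderOf_nsmul_eq_zero, zero_add]

include hmem hγ in
/-- **`red (Y − s) ∈ Ẽ[2]`** for `γ • Y = −Y + t`, `γ • t = t`, `t` of odd order, `s` the half of `t`: `Y′ := Y − s` is `γ`-anti-invariant
(`γ • s = s`, `2s = t`), so §1 applies.  [cite: GrossLMS1991, §5 Prop. 5.3] -/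
theorem two_smul_geomReduction_sub_half_eq_zero {Y t : W.geomPoints} (hY : γ • Y = -Y + t) (ht : γ • t = t)
    (hodd : Odd (addOrderOf t)) :
    (2 : ℤ) • geomReduction hΔ (Y - (((addOrderOf t + 1) / 2 : ℕ) : ℤ) • t) = 0 := by
  refine two_smul_geomReduction_eq_zero_of_inertia_anti (p := p) hΔ hmem hγ ?_
  have h2s := two_smul_half_of_odd_addOrderOf hodd
  set s : W.geomPoints := (((addOrderOf t + 1) / 2 : ℕ) : ℤ) • t with hs
  have hγs : γ • s = s := by rw [hs, smul_zsmul_geomPoints', ht]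
  rw [smul_sub, hY, hγs, neg_sub, sub_eq_iff_eq_add]
  -- `-Y + t = s - Y + s` since `2s = t`
  rw [← h2s, two_smul]
  abel

/-! ## §2 `2`-divisibility inside a `γ`-stable `2`-torsion-free subgroup forces trivial reduction of `Y′` -/

include hmem hγ in
/-- **THE KERNEL OF THE CRITERION.**  `A ≤ E(ℚ̄)` a `γ`-stable subgroup with `A[2] = 0`, `t ∈ A` (and `Y`, implicitly `= 2Q ∈ A`), `γ • Y = −Y + t`, `γ • t = t`, `t` of odd
order, `s` its half.  If `Y = 2 • Q` with `Q ∈ A`, then **`red Y = red s`** (i.e. `red (Y − s) = 0`): `Q′ := Q − (half of s)` satisfies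
`2 • (γQ′ + Q′) = γY′ + Y′ = 0` with `γQ′ + Q′ ∈ A`, hence `γQ′ = −Q′` (`A[2] = 0`), so `red Q′ ∈ Ẽ[2]`-anti… precisely `red Q′ = −red Q′` by
inertia, `red Y′ = 2 • red Q′ = 0`.  Instantiation (see module docstring): `A = E(K[1])`, `Y = y_K`, `t = y_K + τy_K`, `γ` an inertia element at
a prime over a ramified `ℓ₀ ∣ d_K` restricting to `τ` on `K`; then `red y_K = red s` whenever `M₀ ≥ 1`.
[cite: GrossLMS1991, §5 Prop. 5.3, §4 (4.1)] [cite: Serre1972, §1.11, Prop. 11 (proof)] -/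
theorem geomReduction_eq_of_two_smul_of_inertia_anti (A : AddSubgroup W.geomPoints) (hA : ∀ P ∈ A, γ • P ∈ A)
    (hA2 : ∀ P ∈ A, (2 : ℤ) • P = 0 → P = 0) {Y t : W.geomPoints} (htA : t ∈ A)
    (hY : γ • Y = -Y + t) (ht : γ • t = t) (hodd : Odd (addOrderOf t))
    {Q : W.geomPoints} (hQA : Q ∈ A) (hQ : (2 : ℤ) • Q = Y) :
    geomReduction hΔ Y = geomReduction hΔ ((((addOrderOf t + 1) / 2 : ℕ) : ℤ) • t) := by
  have h2s := two_smul_half_of_odd_addOrderOf hodd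
  set s : W.geomPoints := (((addOrderOf t + 1) / 2 : ℕ) : ℤ) • t with hs
  have hsA : s ∈ A := A.zsmul_mem htA _
  have hγs : γ • s = s := by rw [hs, smul_zsmul_geomPoints', ht]
  -- the half of `s`: `s' := ((m+1)/2) • s`, `2 s' = s` (`addOrderOf s ∣ addOrderOf t` is odd, but we only need SOME half in `A`:
  -- `s' := ((m+1)/2) • s` works since `2 • ((m+1)/2) • s = ((m+1)/2) • (2 • s)`… simpler: `s' := ((m+1)/2)^2 • t`)
  set s' : W.geomPoints := (((addOrderOf t + 1) / 2 : ℕ) : ℤ) • s with hs'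
  have h2s' : (2 : ℤ) • s' = s := by
    rw [hs', smul_smul, mul_comm, ← smul_smul, h2s, hs]
  have hs'A : s' ∈ A := A.zsmul_mem hsA _
  have hγs' : γ • s' = s' := by rw [hs', smul_zsmul_geomPoints', hγs]
  -- `Q' := Q - s'`, `2 Q' = Y - s =: Y'`
  set Q' : W.geomPoints := Q - s' with hQ'
  have hQ'A : Q' ∈ A := A.sub_mem hQA hs'A
  have h2Q' : (2 : ℤ) • Q' = Y - s := by rw [hQ', smul_sub, hQ, h2s']
  -- `γ Y' = - Y'`
  have hγY' : γ • (Y - s) = -(Y - s) := by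
    rw [smul_sub, hY, hγs, neg_sub, sub_eq_iff_eq_add, ← h2s, two_smul]; abel
  -- `u := γ Q' + Q'` is killed by `2` and lies in `A`, hence `u = 0`
  have hu2 : (2 : ℤ) • (γ • Q' + Q') = 0 := by
    rw [smul_add, ← smul_zsmul_geomPoints', h2Q', hγY', neg_add_cancel]
  have hu : γ • Q' + Q' = 0 := hA2 _ (A.add_mem (hA _ hQ'A) hQ'A) hu2
  have hγQ' : γ • Q' = -Q' := eq_neg_of_add_eq_zero_left hu
  -- reduce: `red Q' = - red Q'`, so `red Y' = 2 red Q' = 0`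
  have hred2 := two_smul_geomReduction_eq_zero_of_inertia_anti (p := p) hΔ hmem hγ hγQ'
  have hY' : geomReduction hΔ (Y - s) = 0 := by rw [← h2Q', map_zsmul, hred2]
  rwa [map_sub, sub_eq_zero] at hY'

/-! ## §3 The criterion (contrapositive) -/

include hmem hγ in
/-- **THE REDUCTION CRITERION FOR DEPTH ZERO.**  In the frame of §2: if `red Y` is NOT the reduction of a torsion point of `A` (in particular —
for `A` with trivial torsion — if `red Y ≠ Õ`), then `Y ∉ 2 • A`.  For the Heegner point this reads: «`y_K` does not reduce, at a prime over a
RAMIFIED `ℓ₀ ∣ d_K`, into `red (E(H)_tors)` ⟹ `M₀ = 0`» — the input shape of a ramified Jochnowitz congruence, deciding the registered stub C‴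
on the `#Sel₂(E) = 1` cell with `n = 1`.  [cite: GrossLMS1991, §5 Prop. 5.3, §4 (4.1)] [cite: Serre1972, §1.11, Prop. 11 (proof)] -/
theorem not_exists_two_smul_of_geomReduction_notMem_torsion (A : AddSubgroup W.geomPoints) (hA : ∀ P ∈ A, γ • P ∈ A)
    (hA2 : ∀ P ∈ A, (2 : ℤ) • P = 0 → P = 0) {Y t : W.geomPoints} (htA : t ∈ A)
    (hY : γ • Y = -Y + t) (ht : γ • t = t) (hodd : Odd (addOrderOf t))
    (hred : ∀ u ∈ A, IsOfFinAddOrder u → geomReduction hΔ Y ≠ geomReduction hΔ u) :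
    ¬ ∃ Q ∈ A, (2 : ℤ) • Q = Y := by
  rintro ⟨Q, hQA, hQ⟩
  refine hred _ (A.zsmul_mem htA _) ?_ (geomReduction_eq_of_two_smul_of_inertia_anti (p := p) hΔ hmem hγ A hA hA2 htA hY ht hodd hQA hQ)
  exact (addOrderOf_pos_iff.mp hodd.pos).zsmul

/-! ## §4 (APPEND, same seat) Positive depth: the same criterion for DERIVED points `P(n)` — sign `ε_n = ±1`, remainder `2R` -/

include hmem hγ in
/-- **THE CRITERION AT EVERY DEPTH (eigen form).**  `A ≤ E(ℚ̄)` `γ`-stable with `A[2] = 0`, `γ ∈ I_𝔓`; `Y ∈ A` with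
`γ • Y = ε • Y + 2 • R` for an integer `ε` (a sign `±1` in the application) and `R ∈ A` — Gross's Prop. 5.4 for a Kolyvagin derived point
`Y = P(n)`: `τ[P(n)] = ε_n [P(n)]` in `E(K[n])/2E(K[n])`, read for the inertia involution `γ` at a prime over a RAMIFIED `ℓ₀ ∣ d_K` (its restriction
to `K[n]` lies in the coset of `τ`, and `Gal(K[n]/K)` fixes `[P(n)]`, Gross Prop. 3.6).  If `Y = 2 • Q` with `Q ∈ A` then `Q − ε γ… `: precisely
`γ • Q = ε • Q + R` (no `2`-torsion in `A`), hence, reducing (`red ∘ γ = red`), **`(1 − ε) • red Q = red R`**: for `ε = 1`, `red R = 0`; for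
`ε = −1`, `red R = 2 • red Q = red Y`.  Depth `0` (`n = 1`, `ε₁ = −1`, `2R = t` odd torsion) is §2.
[cite: GrossLMS1991, §5 Prop. 5.4, §3 Prop. 3.6] [cite: Serre1972, §1.11, Prop. 11 (proof)] -/
theorem geomReduction_eigen_of_two_smul_of_inertia (A : AddSubgroup W.geomPoints) (hA : ∀ P ∈ A, γ • P ∈ A)
    (hA2 : ∀ P ∈ A, (2 : ℤ) • P = 0 → P = 0) {Y R : W.geomPoints} (hRA : R ∈ A) {ε : ℤ}
    (hY : γ • Y = ε • Y + (2 : ℤ) • R) {Q : W.geomPoints} (hQA : Q ∈ A) (hQ : (2 : ℤ) • Q = Y) :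
    (1 - ε) • geomReduction hΔ Q = geomReduction hΔ R := by
  -- `u := γ Q − ε Q − R ∈ A` is killed by `2`
  have hu2 : (2 : ℤ) • (γ • Q - ε • Q - R) = 0 := by
    rw [smul_sub, smul_sub, ← smul_zsmul_geomPoints', hQ, hY, smul_comm (2 : ℤ) ε Q, hQ]
    abel
  have huA : γ • Q - ε • Q - R ∈ A := A.sub_mem (A.sub_mem (hA _ hQA) (A.zsmul_mem hQA _)) hRA
  have hu : γ • Q - ε • Q - R = 0 := hA2 _ huA hu2
  have hγQ : γ • Q = ε • Q + R := by rw [sub_sub, sub_eq_zero] at hu; rw [hu]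
  have hred := geomReduction_smul_of_mem_inertia (p := p) hΔ hmem hγ Q
  rw [hγQ, map_add, map_zsmul] at hred
  -- `ε • red Q + red R = red Q`
  rw [eq_sub_of_add_eq' hred, sub_smul, one_smul]

include hmem hγ in
/-- **Sign `+1` at positive depth**: `γ • Y = Y + 2 • R`, `Y = 2 • Q` in `A` ⟹ **`red R = 0`**.  CRITERION: `red R ≠ 0 ⟹ Y ∉ 2A`
(`R` = the half of `γP(n) − P(n)`, unique since `A[2] = 0`).  [cite: GrossLMS1991, §5 Prop. 5.4] -/
theorem not_exists_two_smul_of_geomReduction_half_ne_zero (A : AddSubgroup W.geomPoints) (hA : ∀ P ∈ A, γ • P ∈ A)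
    (hA2 : ∀ P ∈ A, (2 : ℤ) • P = 0 → P = 0) {Y R : W.geomPoints} (hRA : R ∈ A)
    (hY : γ • Y = (1 : ℤ) • Y + (2 : ℤ) • R) (hred : geomReduction hΔ R ≠ 0) :
    ¬ ∃ Q ∈ A, (2 : ℤ) • Q = Y := by
  rintro ⟨Q, hQA, hQ⟩
  have h := geomReduction_eigen_of_two_smul_of_inertia (p := p) hΔ hmem hγ A hA hA2 hRA (ε := 1) hY hQA hQ
  rw [sub_self, zero_smul] at h
  exact hred h.symm

include hmem hγ in
/-- **Sign `−1` at positive depth**: `γ • Y = −Y + 2 • R`, `Y = 2 • Q` in `A` ⟹ **`red R = red Y`**.  CRITERION: `red R ≠ red Y ⟹ Y ∉ 2A`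
(`R` = the half of `γP(n) + P(n)`; at `n = 1` this is §3 with `2R = t`).  [cite: GrossLMS1991, §5 Prop. 5.4, Prop. 5.3] -/
theorem not_exists_two_smul_of_geomReduction_half_ne (A : AddSubgroup W.geomPoints) (hA : ∀ P ∈ A, γ • P ∈ A)
    (hA2 : ∀ P ∈ A, (2 : ℤ) • P = 0 → P = 0) {Y R : W.geomPoints} (hRA : R ∈ A)
    (hY : γ • Y = (-1 : ℤ) • Y + (2 : ℤ) • R) (hred : geomReduction hΔ R ≠ geomReduction hΔ Y) :
    ¬ ∃ Q ∈ A, (2 : ℤ) • Q = Y := by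
  rintro ⟨Q, hQA, hQ⟩
  have h := geomReduction_eigen_of_two_smul_of_inertia (p := p) hΔ hmem hγ A hA hA2 hRA (ε := -1) hY hQA hQ
  apply hred
  rw [← h, ← hQ, map_zsmul]
  norm_num

end Summit.BirchSwinnertonDyer.BirchSwinnertonDyer.Theorems.GenusSupplyNarrow

end
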